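import Summits.HodgeConjecture.HodgeConjecture.Theorems.Ring2HypothesesAtlasSixfolds
import Literature.AlgebraicGeometry.HodgeTheory.AbelianVarietyPullbackAlgebraicClasses
import HarnessLib

/-!
# Ring 2 · atlas-2 (generation 19) — the open cell `HodgeQuaternionSixfold` from ONE Weil structure per member: `HC(X) ⟺` the Weil plane of ONE `k ⊂ End⁰(X)` is algebraic, given generation by divisors and the `End`-translates of that plane

HONEST FRAMING: research route conditional on HC_CM; not a corollary; Q11.4-sentence-2 already refuted in dim ≥ 3.

Cell `pub-hodge-ring2`, seat `pub-hodge-ring2-atlas-2` (generation 19). `HC_CM`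
(`Theses.RankFourFaces.CMAbelianHodge`) is NOT used anywhere in this file: KIND of `HC_CM` = ABSENT. Theorems only (no
definitions, no axioms, no `sorry`).

WHAT. The hypotheses layer (`Theorems/Ring2HypothesesAtlasSixfolds.lean` §2, §4) serves the atlas-2 cell
`Ring2.Atlas.HodgeQuaternionSixfold` (simple complex abelian sixfolds with non-commutative `End⁰` and no type-IV
factor) from (G) `IsDivisorMultiWeilGenerated A` — "`B•(A) ⊗ ℂ ⊆ D•(A) ⊗ ℂ + Σ_k W_k ⊗ ℂ` over ALL Weil structures `k
⊂ End⁰(A)`" — and (W) `W₆ = Theses.SevenfoldWeilCensus.WeilSixfolds` (the Weil classes of ALL Weil sixfolds are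
algebraic). This file types the SHARPER per-member reduction recorded in the cell's AV-HODGE-ATLAS §35 / atlas-2
ADDENDUM §35 (row `g6.III(1)`): it suffices to know, for ONE Weil structure `φ` (`φ² = -d`, multiplicity `(n, n)`) of
the member,
* (G₁) generation by divisors OFF the middle degree and, IN the middle degree, by divisors and the `End(A)`-TRANSLATES
  `ψ^* W_φ` (`ψ : A ⟶ A`) of the one complexified Weil plane `W_φ ⊗ ℂ = weilClassesOf A φ n d` — hypotheses `hoff`,
  `hmid` below (inlined; planners file no definitions) — and
* (W₁) the algebraicity of the rational `(n,n)` classes of THAT ONE plane.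

The two inputs give `HodgeConjectureFor A.dim A.X`; conversely `HC(A)` gives (W₁) back (on path). ENGINE:
`hodgeConjectureFor_of_oneWeilTranslatesGenerated` (any dimension `2n`): `D• ⊗ ℂ ⊆ N•` unconditionally (tree theorem
`divisorClassesSpan_le_algebraicClasses_holds`, Lefschetz `(1,1)` and products), `W_φ ⊗ ℂ ⊆ Nⁿ` from (W₁) (typer 1's
`IsWeilType.weilClassesOf_le_algebraicClasses`, van Geemen 4.9 / Lemma 5.2 (3)), and `ψ^*(Nⁿ) ⊆ Nⁿ` for every `ψ : A ⟶
A` (tree theorem `map_mem_algebraicClasses_of_abelianVariety`, Fulton Cor. 19.2 (b)). ROW: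
`hodgeConjectureFor_iff_weilClassesOf_algebraic_of_oneWeilTranslatesGenerated` — under (G₁), `HC(A) ⟺ (W₁)`. CELL:
`hodgeQuaternionSixfold_of_oneWeilTranslatesGenerated_of_weilSixfolds` ((G₁) or `B• = D•` on each member, + `W₆`) and
`hodgeQuaternionSixfold_of_oneWeilTranslatesGenerated` ((G₁) + (W₁) for the member's own plane, no `W₆`).

WHY (G₁) IS THE RIGHT HYPOTHESIS FOR THE TYPE III(1) MEMBERS. In print, verbatim (B. van Geemen, A. Verra,
*Quaternionic Pryms and Hodge classes*, Topology 42 (2003) [vanGeemenVerra2003QuaternionicPryms]; their `F` = the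
definite quaternion algebra, here `D = End⁰(X)`; their `K` = an imaginary quadratic subfield, here `k = ℚ(φ)`): §4.6
"We define the subspace `W_F ⊂ H^{2n}(A, ℚ)` as the subspace spanned by the translates `x·W_K` where `x` runs over `F`
and `W_K` is the space of Weil classes for the field `K`"; Prop. 4.7 "The definition of `W_F` does not depend on the
choice of `K ⊂ F` and `W_F ⊂ H^{2n}(A, ℚ) ∩ H^{n,n}(A)`, `dim_ℚ W_F = 2n + 1`" (proof: `W_F ⊗ ℂ = V_{2n+1}`, the
unique irreducible `GL₂(ℂ) = (F ⊗ ℂ)^*`-summand of dimension `2n + 1` of `∧^{2n} H¹(A, ℂ)`); §4.8 "For a general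
polarized `2n`-dimensional abelian variety `(A, E)` of quaternion type (i.e. `Hod(A)(ℂ) ≅ SO(2n, ℂ)`) one has ([A],
Thm 4.1): `Bⁿ(A) ≅ ⟨∧ⁿE⟩ ⊕ W_F`, `Bⁱ(A) = ⟨∧ⁱE⟩ (i ≠ n)`" ([A] = S. Abdulali, *Abelian varieties of type III and the
Hodge conjecture*, Int. J. Math. 10 (1999), Thm. 4.1 [Abdulali1999TypeIII]); Cor. 4.9 "(Abdulali [A].) … Assume there
is a quadratic subfield `K ⊂ F` such that the space of Weil classes `W_K` is spanned by cycle classes. Then the space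
of quaternionic classes `W_F` is spanned by cycle classes. This follows from the fact that `W_F` is spanned by the
translates of `W_K` by elements of `F ⊂ End(A)`." So for `n = 3`: (G₁) IS §4.8 (with `ψ` ranging over `End(A)`, an
order in `D`, whose non-zero elements are invertible in `D` and Zariski-dense in `(D ⊗ ℂ)^* = GL₂(ℂ)`), PRINT for the
general member; §1–§2 below are the tree form of the mechanism of Cor. 4.9. That the hypothesis of §4.8 (`Hg = G`)
holds for EVERY simple type III(1) sixfold, not only the general one, is the cell's DERIVED census (atlas-2 ADDENDUM
§23: `SO₆` has no proper connected subgroup acting irreducibly and orthogonally on `ℂ⁶`, and `End⁰(X) = D` forces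
absolute irreducibility of the six-space) — NOT a tree theorem: the tree carries the Hodge group on the carriers
(`HodgeTheory.hodgeGroup`, `VanGeemen1994.hodgeGroupOne`) and the Weil-type predicate `VanGeemen1994.HasHodgeGroupSU`
with the vendored fact `VanGeemen1994_thm612` (Thm. 6.12, `Hg = SU(φ)`), but as yet no type III analogue ("`A` is a
general member of its PEL family", `Hod(A) = G = Aut_D(V, T)⁰`, [Abdulali2002TypeIII] §4) and no vendoring of §4.8 /
[A] Thm. 4.1 — with those, (G₁) for the general member would be a named-fact instance; the explicit
decomposition `B³_exc ⊗ ℂ = det W ⊗ Sym⁶ U = Σ_k W_k ⊗ ℂ` (`H¹(X, ℂ) = W ⊗ U`, `W_k ⊗ ℂ = det W ⊗ ⟨u₊^{⊗6}, u₋^{⊗6}⟩`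
for the eigenlines `u_±` of `k` on `U`; any four subfields suffice, three never) is the cell's exact certificate
`data/atlas/span3/span_g6III1_B.json` (generation 19) together with seat ab-weil-2's orbit lemma (WEIL-CELLS §R2). For
these members van Geemen's one-structure predicate `IsDivisorWeilGenerated A φ 3 d` FAILS (`b₃ - d₃ = 7 > 2`): (G) of
the hypotheses layer or (G₁) here is the correct generation input. For the type II members of the cell (`End⁰(X)` an
indefinite quaternion algebra over `ℚ` or over a totally real cubic field) all Hodge classes of all powers are divisor
classes — V. K. Murty, Proc. AMS 104 (1988), Thm. 2, bound Summit-side in generation 18's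
`Theorems/Ring2AtlasTypeIIRows.lean` [Murty1988] — the first disjunct of the cell theorems of §3. Powers: S. Abdulali,
*Hodge structures on abelian varieties of type III*, Ann. of Math. 155 (2002), Thm. 4.1 with Rem. 5.4 ("For odd `m`,
discT is not a square (it is negative), so Theorem 4.1 applies"): for such an `X` (`m = 3`) the usual Hodge conjecture
for `X` implies the usual and the general Hodge conjecture for all powers of `X` [Abdulali2002TypeIII] — recorded, not
typed.

TREE STATUS after this file: the open cell is reduced, per member and in the kernel, to the algebraicity of ONE
two-dimensional Weil plane, modulo the typed generation hypothesis (G₁) (DERIVED in the records, PRINT for the general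
member); before: modulo (G) over all Weil structures and `W₆` for all Weil sixfolds. Nothing here asserts (G₁), (W₁)
or `W₆`. ON PATH (§4): (W₁) is a consequence of the cell, hence of `HC_AV` and of the summit.

References: [vanGeemenVerra2003QuaternionicPryms] Prop. 4.7, §4.8, Cor. 4.9; [Abdulali1999TypeIII] Thm. 4.1;
[Abdulali2002TypeIII] Thm. 4.1, Rem. 4.2, Rem. 5.4; [vanGeemen1994HodgeAV] 2.4, 4.9, 4.11, Lemma 5.2, Thm. 6.12;
[MoonenZarhin1999LowDim] (1.8), §5; [Murty1984] §3 (type III examples); [Murty1988] Thm. 2; [Fulton1998] Cor. 19.2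
(b).
-/

set_option linter.dupNamespace false

noncomputable section

namespace Summit.HodgeConjecture.HodgeConjecture.Ring2.Atlas

open CategoryTheory
open Literature.AlgebraicGeometry Literature.AlgebraicGeometry.Motives
open Literature.AlgebraicGeometry.HodgeTheory
open Literature.AlgebraicTopology.SingularHomology
open Literature.Barriers.HodgeConjecture (divisorClassesSpan)
open Summit.HodgeConjecture.HodgeConjecture.WeilTypeLadder
open Summit.HodgeConjecture.HodgeConjecture.Theses
open Summit.HodgeConjecture.HodgeConjecture.Ring2.ClassTargets
open Summit.HodgeConjecture.HodgeConjecture.Ring2.Hypotheses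
open Summit.HodgeConjecture.HodgeConjecture.Theorems.HodgeAbelianVarieties.Unconditional
  (divisorClassesSpan_le_algebraicClasses_holds hodgeConjectureFor_of_divisorGenerated_holds)

variable {A : AbelianVariety ℂ} {φ : A ⟶ A} {n d : ℕ}

/-! ## §1 `End`-translates of an algebraic Weil plane are algebraic -/

/-- **A translate `ψ^*(W_φ ⊗ ℂ)` of the complexified Weil plane by an endomorphism `ψ : A ⟶ A` consists of
algebraic classes as soon as the rational `(n,n)` classes of the plane are algebraic**: the plane is the complex
span of its rational classes, all of type `(n,n)` under Weil type (van Geemen 4.9, Lemma 5.2 (3):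
`IsWeilType.weilClassesOf_le_algebraicClasses`), and pull-back along a morphism into an abelian variety preserves
algebraic classes (Fulton Cor. 19.2 (b): `map_mem_algebraicClasses_of_abelianVariety`).
[cite: vanGeemen1994HodgeAV, 4.9 and Lemma 5.2 (3)] [cite: Fulton1998, §19.2 Cor. 19.2 (b)] -/
theorem map_weilClassesOf_le_algebraicClasses (h : IsWeilType A φ n d)
    (hW : ∀ c ∈ weilClassesOf A φ n d, IsRationalClass c → IsOfHodgeType (2 * n) A.X (2 * n) n n c →
      c ∈ algebraicClasses A.X n) (ψ : A ⟶ A) :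
    (weilClassesOf A φ n d).map (complexBetti.map ψ.hom.hom.hom (2 * n)).hom ≤ algebraicClasses A.X n := by
  refine Submodule.map_le_iff_le_comap.2 fun w hw ↦ ?_
  exact map_mem_algebraicClasses_of_abelianVariety
    (AbelianVariety.isSmoothProjective_holds : IsSmoothProjective A.dim A.X) A ψ.hom.hom.hom
    (h.weilClassesOf_le_algebraicClasses hW hw)

/-- … hence so does the span `Σ_ψ ψ^*(W_φ ⊗ ℂ)` of all `End`-translates of the plane.
[cite: vanGeemen1994HodgeAV, 4.9 and Lemma 5.2 (3)] [cite: Fulton1998, §19.2 Cor. 19.2 (b)] -/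
theorem iSup_map_weilClassesOf_le_algebraicClasses (h : IsWeilType A φ n d)
    (hW : ∀ c ∈ weilClassesOf A φ n d, IsRationalClass c → IsOfHodgeType (2 * n) A.X (2 * n) n n c →
      c ∈ algebraicClasses A.X n) :
    (⨆ ψ : A ⟶ A, (weilClassesOf A φ n d).map (complexBetti.map ψ.hom.hom.hom (2 * n)).hom) ≤
      algebraicClasses A.X n :=
  iSup_le fun ψ ↦ map_weilClassesOf_le_algebraicClasses h hW ψ

/-! ## §2 ENGINE — `HC(A)` from generation by divisors and the `End`-translates of ONE Weil plane -/

/-- **ENGINE (any dimension `2n`).** Let `(A, φ)` be of Weil type (`φ² = -d`, multiplicity `(n,n)`). If (G₁) every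
rational `(p,p)` class of `A` lies in the complexified divisor ring `Dᵖ ⊗ ℂ` for `p ≠ n` (`hoff`) and in
`Dⁿ ⊗ ℂ + Σ_{ψ ∈ End A} ψ^*(W_φ ⊗ ℂ)` for `p = n` (`hmid`), and (W₁) the rational `(n,n)` classes of the ONE plane
`W_φ ⊗ ℂ` are algebraic (`hW`), then the Hodge conjecture holds for `A`: `D• ⊗ ℂ ⊆ N•` by Lefschetz `(1,1)` and
products (tree theorem `divisorClassesSpan_le_algebraicClasses_holds`), the translates by §1. For a simple type III(1)
sixfold, (G₁) with `n = 3` is the van Geemen–Verra / Abdulali description of the Hodge ring of the general member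
(`B³ = D³ ⊕ W_F`, `W_F` spanned by the `D^×`-conjugates of one `W_k`; DERIVED for every member in the cell's records) —
a HYPOTHESIS here. [cite: vanGeemenVerra2003QuaternionicPryms, §4.6, Prop. 4.7, §4.8 and Cor. 4.9]
[cite: Abdulali1999TypeIII, Thm. 4.1] [cite: vanGeemen1994HodgeAV, 2.4 and Thm. 6.12] -/
theorem hodgeConjectureFor_of_oneWeilTranslatesGenerated (h : IsWeilType A φ n d)
    (hoff : ∀ (p : ℕ) (c : complexBetti A.X (2 * p)), p ≠ n → IsRationalClass c →
      IsOfHodgeType A.dim A.X (2 * p) p p c → c ∈ divisorClassesSpan A.X A.dim p)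
    (hmid : ∀ c : complexBetti A.X (2 * n), IsRationalClass c → IsOfHodgeType A.dim A.X (2 * n) n n c →
      c ∈ divisorClassesSpan A.X A.dim n ⊔
        ⨆ ψ : A ⟶ A, (weilClassesOf A φ n d).map (complexBetti.map ψ.hom.hom.hom (2 * n)).hom)
    (hW : ∀ c ∈ weilClassesOf A φ n d, IsRationalClass c → IsOfHodgeType (2 * n) A.X (2 * n) n n c →
      c ∈ algebraicClasses A.X n) :
    HodgeConjectureFor A.dim A.X := by
  refine ⟨nonempty_hodgeModel_holds (AbelianVariety.isSmoothProjective_holds (A := A)), fun p c hc hH ↦ ?_⟩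
  by_cases hp : p = n
  · subst hp
    exact sup_le (divisorClassesSpan_le_algebraicClasses_holds A p)
      (iSup_map_weilClassesOf_le_algebraicClasses h hW) (hmid c hc hH)
  · exact divisorClassesSpan_le_algebraicClasses_holds A p (hoff p c hp hc hH)

/-- **THE ROW WORD (atlas-2 `g6.III(1)`, ADDENDUM §35): under (G₁), `HC(A) ⟺` the rational `(n,n)` classes of the
ONE Weil plane `W_φ ⊗ ℂ` are algebraic.** (`⟹` is on path: Weil classes are Hodge classes,
`weilClasses_algebraic_of_hodgeConjectureFor`.) [cite: vanGeemenVerra2003QuaternionicPryms, Cor. 4.9]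
[cite: vanGeemen1994HodgeAV, Thm. 4.11] -/
theorem hodgeConjectureFor_iff_weilClassesOf_algebraic_of_oneWeilTranslatesGenerated (h : IsWeilType A φ n d)
    (hoff : ∀ (p : ℕ) (c : complexBetti A.X (2 * p)), p ≠ n → IsRationalClass c →
      IsOfHodgeType A.dim A.X (2 * p) p p c → c ∈ divisorClassesSpan A.X A.dim p)
    (hmid : ∀ c : complexBetti A.X (2 * n), IsRationalClass c → IsOfHodgeType A.dim A.X (2 * n) n n c →
      c ∈ divisorClassesSpan A.X A.dim n ⊔
        ⨆ ψ : A ⟶ A, (weilClassesOf A φ n d).map (complexBetti.map ψ.hom.hom.hom (2 * n)).hom) :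
    HodgeConjectureFor A.dim A.X ↔
      ∀ c ∈ weilClassesOf A φ n d, IsRationalClass c → IsOfHodgeType (2 * n) A.X (2 * n) n n c →
        c ∈ algebraicClasses A.X n :=
  ⟨weilClasses_algebraic_of_hodgeConjectureFor h, hodgeConjectureFor_of_oneWeilTranslatesGenerated h hoff hmid⟩

/-- **Comparison with typer 1's one-structure generation**: van Geemen's `IsDivisorWeilGenerated A φ n d`
(`Bⁿ ⊆ Dⁿ + W_φ`, the general member of a Weil-type FAMILY, Thm. 6.12) implies (G₁) — the translate by `ψ = 𝟙`
alone suffices. (For a type III(1) member `IsDivisorWeilGenerated` FAILS — seven exceptional dimensions, one plane has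
two — and (G₁) is the correct replacement.) [cite: vanGeemen1994HodgeAV, Thm. 6.12] -/
theorem oneWeilTranslatesGenerated_of_isDivisorWeilGenerated (hDW : IsDivisorWeilGenerated A φ n d) :
    (∀ (p : ℕ) (c : complexBetti A.X (2 * p)), p ≠ n → IsRationalClass c →
        IsOfHodgeType A.dim A.X (2 * p) p p c → c ∈ divisorClassesSpan A.X A.dim p) ∧
      ∀ c : complexBetti A.X (2 * n), IsRationalClass c → IsOfHodgeType A.dim A.X (2 * n) n n c →
        c ∈ divisorClassesSpan A.X A.dim n ⊔
          ⨆ ψ : A ⟶ A, (weilClassesOf A φ n d).map (complexBetti.map ψ.hom.hom.hom (2 * n)).hom := by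
  have hle : weilClassesOf A φ n d ≤
      ⨆ ψ : A ⟶ A, (weilClassesOf A φ n d).map (complexBetti.map ψ.hom.hom.hom (2 * n)).hom := by
    refine le_iSup_of_le (𝟙 A) fun w hw ↦ ⟨w, hw, ?_⟩
    have hid : complexBetti.map ((𝟙 A : A ⟶ A)).hom.hom.hom (2 * n) = 𝟙 _ := complexBetti.map_id (2 * n)
    rw [hid]
    rfl
  exact ⟨hDW.1, fun c hc hH ↦ sup_le_sup_left hle _ (hDW.2 c hc hH)⟩

/-! ## §3 THE CELL `HodgeQuaternionSixfold` from ONE Weil structure per member -/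

/-- **Cell III(1) ⟸ [(G₁) for ONE Weil structure, or `B• = D•`] on each member + (W) `W₆`.** For every simple
sixfold `A` with non-commutative `End⁰(A)` and no type-IV factor, EITHER every rational Hodge class is in the
complexified divisor ring (the type II members: Murty 1988 Thm. 2, generation 18's rows) OR `A` carries a Weil structure
`(φ, d)` of multiplicity `(3,3)` with (G₁) (the type III(1) members: van Geemen–Verra Prop. 4.7–Cor. 4.9 for the
general member; DERIVED for all in the cell's records); then `W₆` gives the cell. Sharper than the hypotheses layer's
`hodgeQuaternionSixfold_of_multiWeilGenerated_of_weilSixfolds` in the generation input (one structure and its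
translates instead of all structures). [cite: vanGeemenVerra2003QuaternionicPryms, §4.6, Prop. 4.7, §4.8 and Cor. 4.9]
[cite: Murty1988, Thm. 2] [cite: MoonenZarhin1999LowDim, (1.8) and §5] [cite: Murty1984, §3] -/
theorem hodgeQuaternionSixfold_of_oneWeilTranslatesGenerated_of_weilSixfolds
    (hgen : ∀ A : AbelianVariety ℂ, A.dim = 6 ∧ A.IsSimple ∧ (∃ ψ χ : A ⟶ A, ψ ≫ χ ≠ χ ≫ ψ) ∧
      HasNoTypeIVFactor A →
      (∀ (p : ℕ) (c : complexBetti A.X (2 * p)), IsRationalClass c → IsOfHodgeType A.dim A.X (2 * p) p p c →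
          c ∈ divisorClassesSpan A.X A.dim p) ∨
        ∃ (φ : A ⟶ A) (d : ℕ), IsWeilType A φ 3 d ∧
          (∀ (p : ℕ) (c : complexBetti A.X (2 * p)), p ≠ 3 → IsRationalClass c →
              IsOfHodgeType A.dim A.X (2 * p) p p c → c ∈ divisorClassesSpan A.X A.dim p) ∧
          ∀ c : complexBetti A.X (2 * 3), IsRationalClass c → IsOfHodgeType A.dim A.X (2 * 3) 3 3 c →
            c ∈ divisorClassesSpan A.X A.dim 3 ⊔
              ⨆ ψ : A ⟶ A, (weilClassesOf A φ 3 d).map (complexBetti.map ψ.hom.hom.hom (2 * 3)).hom)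
    (hW₆ : SevenfoldWeilCensus.WeilSixfolds) : HodgeQuaternionSixfold := by
  intro A hA
  rcases hgen A hA with hD | ⟨φ, d, hWT, hoff, hmid⟩
  · exact hodgeConjectureFor_of_divisorGenerated_holds A hD
  · exact hodgeConjectureFor_of_oneWeilTranslatesGenerated hWT hoff hmid
      (weilClasses_algebraic_of_weilSixfolds hW₆ A hA.1 3 d φ hWT)

/-- **Cell III(1) ⟸ per member: `B• = D•`, or ONE Weil structure with (G₁) whose OWN plane has algebraic rational
`(3,3)` classes (W₁)** — no `W₆`: the cell asks, member by member, for ONE two-dimensional space of algebraic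
classes. [cite: vanGeemenVerra2003QuaternionicPryms, §4.6 and Cor. 4.9] [cite: Murty1988, Thm. 2]
[cite: MoonenZarhin1999LowDim, (1.8) and §5] -/
theorem hodgeQuaternionSixfold_of_oneWeilTranslatesGenerated
    (hgen : ∀ A : AbelianVariety ℂ, A.dim = 6 ∧ A.IsSimple ∧ (∃ ψ χ : A ⟶ A, ψ ≫ χ ≠ χ ≫ ψ) ∧
      HasNoTypeIVFactor A →
      (∀ (p : ℕ) (c : complexBetti A.X (2 * p)), IsRationalClass c → IsOfHodgeType A.dim A.X (2 * p) p p c →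
          c ∈ divisorClassesSpan A.X A.dim p) ∨
        ∃ (φ : A ⟶ A) (d : ℕ), IsWeilType A φ 3 d ∧
          (∀ (p : ℕ) (c : complexBetti A.X (2 * p)), p ≠ 3 → IsRationalClass c →
              IsOfHodgeType A.dim A.X (2 * p) p p c → c ∈ divisorClassesSpan A.X A.dim p) ∧
          (∀ c : complexBetti A.X (2 * 3), IsRationalClass c → IsOfHodgeType A.dim A.X (2 * 3) 3 3 c →
            c ∈ divisorClassesSpan A.X A.dim 3 ⊔
              ⨆ ψ : A ⟶ A, (weilClassesOf A φ 3 d).map (complexBetti.map ψ.hom.hom.hom (2 * 3)).hom) ∧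
          ∀ c ∈ weilClassesOf A φ 3 d, IsRationalClass c → IsOfHodgeType (2 * 3) A.X (2 * 3) 3 3 c →
            c ∈ algebraicClasses A.X 3) :
    HodgeQuaternionSixfold := by
  intro A hA
  rcases hgen A hA with hD | ⟨φ, d, hWT, hoff, hmid, hW⟩
  · exact hodgeConjectureFor_of_divisorGenerated_holds A hD
  · exact hodgeConjectureFor_of_oneWeilTranslatesGenerated hWT hoff hmid hW

/-! ## §4 ON PATH — (W₁) is a consequence of the cell (and so of `HC_AV` and of the summit) -/

/-- **On path**: the cell gives back, on every member and for EVERY Weil structure of it, the algebraicity of the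
rational `(3,3)` classes of the Weil plane (bookkeeping: the input (W₁) of §3 is a CASE of the cell, nothing here is
stronger than the Clay statement). [cite: vanGeemen1994HodgeAV, Thm. 4.11] -/
theorem weilClassesOf_algebraic_of_hodgeQuaternionSixfold (hQ : HodgeQuaternionSixfold) (A : AbelianVariety ℂ)
    (hA : A.dim = 6 ∧ A.IsSimple ∧ (∃ ψ χ : A ⟶ A, ψ ≫ χ ≠ χ ≫ ψ) ∧ HasNoTypeIVFactor A) (φ : A ⟶ A) (d : ℕ)
    (hWT : IsWeilType A φ 3 d) :
    ∀ c ∈ weilClassesOf A φ 3 d, IsRationalClass c → IsOfHodgeType (2 * 3) A.X (2 * 3) 3 3 c →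
      c ∈ algebraicClasses A.X 3 :=
  weilClasses_algebraic_of_hodgeConjectureFor hWT (hQ A hA)

end Summit.HodgeConjecture.HodgeConjecture.Ring2.Atlas
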